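/-
Copyright (c) 2026 the pub-hodgecm-mathlib formalisation cell (harness21).  Prover seat hodgecm-mathlib-K2E3-p12 (g2), Track B «K2-LIT» ∕ h413
(`stmt-HodgeConjecture-24833`), line `K2_E3_EllipticInputs`, unit U12-d «Harish-Chandra characters»: the Weyl discriminant of the INVERSE —
`disc(χ_{A⁻¹}) · det(A)^{2(N−1)} = disc(χ_A)` for every `N` over every commutative ring (the weight `|D_G(g⁻¹)| = |D_G(g)|`), by the «roots over an algebraically
closed field + universal matrix» method of ★ `K2E3CayleyCharpolyDiscr`.  2026-09-04.
-/
import Summits.HodgeConjecture.HodgeConjecture.Theorems.K2E3CayleyCharpolyDiscr        -- ★ p855189∕p855157 (K2E3-p12 g0): `det_smul_one_sub_smul_eq_prod`, `exists_eq_prod_X_sub_C_of_splits`, `prod_prod_Ioi_mul_eq_pow`, `map_nonsing_inv_of_isUnit`, `map_discr_charpoly`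
import Literature.NumberTheory.Rogawski1990.LocalTransfer                                -- ★ `IsRegularElt`
import Literature.LinearAlgebra.Matrix.CharpolyDiscTwinBridge                           -- ★ `isUnit_discr_iff_separable_of_monic`
import HarnessLib

/-!
# K2_E3 road (h413 = stmt-HodgeConjecture-24833), unit U12-d kit — `disc(χ_{A⁻¹}) · det(A)^{2(N−1)} = disc(χ_A)` (every `N`, every commutative ring)

Cell `pub/hodgecm-mathlib` (D-0151), Track B (21-frontier RULING «PUSH BOTH» 2026-09-03, director req624), seat K2E3-p12 (g2), line lead of row 12 (12-S).
`--supports stmt-HodgeConjecture-24833 --as helper`; THEOREMS ONLY (no definition ∕ instance ∕ notation ∕ named fact ∕ `sorry`); never imports `Cruxes/…/Lines`.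

The weight of socket U12-d is `√√‖u‖`, `u·det(g)^{N−1} = disc χ_g` (`u = ± D_G(g) = ± Π_{i≠j}(1 − λ_i∕λ_j)`).  Harish-Chandra's `D_G` is invariant under `g ↦ g⁻¹` (the roots
invert).  In the socket's currency: **`disc(χ_{A⁻¹}) · det(A)^{2(N−1)} = disc(χ_A)`** (`(λ_j⁻¹ − λ_i⁻¹)² = (λ_i − λ_j)²∕(λ_iλ_j)²` and `Π_{i<j}(λ_iλ_j)² = (Π λ)^{2(N−1)}`).
Needed by the SPLIT-PLACE transport of row 12 (the second component of `g ∈ U_N(H)(L⁺_v) ≤ GL_N(L_w × L_w̄)` is `J⁻¹(σ g_w)⁻ᵀ J`, so its weight is that of `g_w⁻¹`):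
the admissible unit is `conjLocal`-invariant and `‖u‖ = |u_w|_w²`.  PROOF = the method of ★ `K2E3CayleyCharpolyDiscr(Field)` (K2E3-p12 (g0)): over an algebraically
closed field `χ_A = Π(T − ξ_i)` and `χ_{A⁻¹}·C(det A) = Π(C ξ_i·T − 1)` (values at every `t`: `det(t − A⁻¹)·det A = det(tA − 1) = Π(tξ_i − 1)`, ★
`det_smul_one_sub_smul_eq_prod`), so `χ_{A⁻¹} = Π(T − ξ_i⁻¹)` and ★ `discr_prod_X_sub_C_eq_prod_prod_Ioi_sq` gives the identity (§1); the universal matrix over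
`ℤ[X_ij][det X⁻¹]` (a domain, Mathlib `Matrix.det_mvPolynomialX_ne_zero`) embedded in an algebraic closure transfers it to every commutative ring (§2–§3, both sides
natural: ★ `map_nonsing_inv_of_isUnit`, ★ `map_discr_charpoly`).  §3 also records the `GL_N` form and **`isRegularElt_inv_iff`** (`g⁻¹` regular ⟺ `g` regular).
[BasuPollackRoy2006, Ch. 4 §4.1 (discriminant = `Π_{i<j}(x_i − x_j)²`), §4.3.1] [HarishChandra1999AdmissibleDistributions, §17 (`D_G`)] [Rogawski1990, §3.1 p. 19].
HONEST LABEL: pure algebra; HC_CM is proved only modulo the 7 printed citations (2 remaining named inputs: hLiu418 = stmt-HodgeConjecture-24832, h413 =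
stmt-HodgeConjecture-24833) until rung 0 closes.

## References
* [BasuPollackRoy2006] S. Basu, R. Pollack, M.-F. Roy, *Algorithms in Real Algebraic Geometry*, 2nd ed. (2006), Ch. 4 §4.1, §4.3.1.
* [HarishChandra1999AdmissibleDistributions] Harish-Chandra (DeBacker–Sally), *Admissible Invariant Distributions on Reductive p-adic Groups* (1999), §17.
* [Rogawski1990] J. Rogawski, *Automorphic Representations of Unitary Groups in Three Variables*, Annals of Math. Studies 123 (1990), §3.1 p. 19 (regular elements).
-/

set_option autoImplicit false
set_option linter.dupNamespace false   -- `Summit.HodgeConjecture.HodgeConjecture.…` (D-0017 nested layout; lakefile exemption for Summits)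

open Polynomial Finset
open Summit.HodgeConjecture.HodgeConjecture.Cruxes.H413.K2E3CayleyCharpolyDiscrField
open Summit.HodgeConjecture.HodgeConjecture.Cruxes.H413.K2E3CayleyCharpolyDiscr

namespace Summit.HodgeConjecture.HodgeConjecture.Cruxes.H413.K2E3CharpolyDiscrInv

/-! ## §1 Over a field: roots of `χ_{A⁻¹}` are the inverses of the roots of `χ_A` -/

section Field

variable {L : Type*} [Field L] {N : ℕ}

/-- `det A = Π ξ_i` when `χ_A = Π (T − ξ_i)` (★ `det_smul_one_sub_smul_eq_prod` with `a = 0`, `b = −1`). [cite: BasuPollackRoy2006, Ch. 4 §4.1] -/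
theorem det_eq_prod (A : Matrix (Fin N) (Fin N) L) (ξ : Fin N → L) (hξ : A.charpoly = ∏ i, (X - C (ξ i))) : A.det = ∏ i, ξ i := by
  have h := det_smul_one_sub_smul_eq_prod A ξ hξ 0 (-1)
  simp only [zero_smul, zero_sub, neg_smul, one_smul, neg_neg, neg_mul, one_mul] at h
  exact h

/-- `χ_{A⁻¹}(t) · det A = Π (t ξ_i − 1)` for every scalar `t`, when `χ_A = Π (T − ξ_i)` and `det A ≠ 0` (`det(t·1 − A⁻¹)·det A = det(t·A − 1) = (−1)^N det(1·1 − t·A)`,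
★ `det_smul_one_sub_smul_eq_prod` with `a = 1`, `b = t`). [cite: BasuPollackRoy2006, Ch. 4 §4.1] -/
theorem eval_charpoly_inv_mul_det (A : Matrix (Fin N) (Fin N) L) (ξ : Fin N → L) (hξ : A.charpoly = ∏ i, (X - C (ξ i))) (h : A.det ≠ 0) (t : L) :
    (A⁻¹).charpoly.eval t * A.det = ∏ i, (t * ξ i - 1) := by
  have hinv : A⁻¹ * A = 1 := Matrix.nonsing_inv_mul A (isUnit_iff_ne_zero.2 h)
  have hmat : (Matrix.scalar (Fin N) t - A⁻¹) * A = -((1 : L) • (1 : Matrix (Fin N) (Fin N) L) - t • A) := by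
    rw [Matrix.scalar_apply, ← Matrix.smul_one_eq_diagonal, sub_mul, smul_mul_assoc, one_mul, hinv, one_smul, neg_sub]
  rw [Matrix.eval_charpoly, ← Matrix.det_mul, hmat, Matrix.det_neg, det_smul_one_sub_smul_eq_prod A ξ hξ 1 t, Fintype.card_fin]
  have hN : (-1 : L) ^ N = ∏ _i : Fin N, (-1 : L) := by rw [Finset.prod_const, Finset.card_univ, Fintype.card_fin]
  rw [hN, ← Finset.prod_mul_distrib]
  exact Finset.prod_congr rfl fun i _ => by ring

/-- **`χ_{A⁻¹} · C(det A) = Π_i (C ξ_i · T − 1)`** in `L[T]` (`L` infinite: equality of values at every `t`). [cite: BasuPollackRoy2006, Ch. 4 §4.1] -/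
theorem charpoly_inv_mul_C_det_eq_prod [Infinite L] (A : Matrix (Fin N) (Fin N) L) (ξ : Fin N → L) (hξ : A.charpoly = ∏ i, (X - C (ξ i))) (h : A.det ≠ 0) :
    (A⁻¹).charpoly * C A.det = ∏ i, (C (ξ i) * X - 1) := by
  apply Polynomial.funext
  intro t
  rw [eval_mul, eval_C, eval_charpoly_inv_mul_det A ξ hξ h t, Polynomial.eval_prod]
  exact Finset.prod_congr rfl fun i _ => by rw [eval_sub, eval_mul, eval_C, eval_X, eval_one, mul_comm]

/-- **`χ_{A⁻¹} = Π_i (T − ξ_i⁻¹)`** for `χ_A = Π (T − ξ_i)`, `det A ≠ 0` (so no `ξ_i = 0`; cancel `C(det A) = Π C ξ_i` in the domain `L[T]`). [cite: BasuPollackRoy2006, Ch. 4 §4.1] -/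
theorem charpoly_inv_eq_prod [Infinite L] (A : Matrix (Fin N) (Fin N) L) (ξ : Fin N → L) (hξ : A.charpoly = ∏ i, (X - C (ξ i))) (h : A.det ≠ 0) :
    (A⁻¹).charpoly = ∏ i, (X - C (ξ i)⁻¹) := by
  have hd := det_eq_prod A ξ hξ
  have hi : ∀ i, ξ i ≠ 0 := fun i h0 => h (by rw [hd]; exact Finset.prod_eq_zero (Finset.mem_univ i) h0)
  have hmain := charpoly_inv_mul_C_det_eq_prod A ξ hξ h
  have hfac : ∏ i, (C (ξ i) * X - 1 : L[X]) = (∏ i, (X - C (ξ i)⁻¹)) * C A.det := by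
    rw [hd, map_prod C, ← Finset.prod_mul_distrib]
    refine Finset.prod_congr rfl fun i _ => ?_
    rw [sub_mul, ← C_mul, inv_mul_cancel₀ (hi i), C_1, mul_comm X (C (ξ i))]
  rw [hfac] at hmain
  exact mul_right_cancel₀ (by rwa [Ne, Polynomial.C_eq_zero]) hmain

/-- **`disc(χ_{A⁻¹}) · det(A)^{2(N−1)} = disc(χ_A)`** when `χ_A = Π (T − ξ_i)` splits and `det A ≠ 0`: ★ `discr_prod_X_sub_C_eq_prod_prod_Ioi_sq` on both sides,
`ξ_j⁻¹ − ξ_i⁻¹ = (ξ_i − ξ_j)∕(ξ_iξ_j)` and `Π_{i<j}(ξ_iξ_j)² = (Π ξ)^{2(N−1)} = det(A)^{2(N−1)}` (★ `prod_prod_Ioi_mul_eq_pow`). [cite: BasuPollackRoy2006, Ch. 4 §4.1] -/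
theorem discr_charpoly_inv_mul_det_pow_of_eq_prod [Infinite L] (A : Matrix (Fin N) (Fin N) L) (ξ : Fin N → L)
    (hξ : A.charpoly = ∏ i, (X - C (ξ i))) (h : A.det ≠ 0) :
    (A⁻¹).charpoly.discr * A.det ^ (2 * (N - 1)) = A.charpoly.discr := by
  have hd := det_eq_prod A ξ hξ
  have hi : ∀ i, ξ i ≠ 0 := fun i h0 => h (by rw [hd]; exact Finset.prod_eq_zero (Finset.mem_univ i) h0)
  rw [charpoly_inv_eq_prod A ξ hξ h, hξ,
    Literature.Algebra.Polynomial.DiscriminantRootProduct.discr_prod_X_sub_C_eq_prod_prod_Ioi_sq,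
    Literature.Algebra.Polynomial.DiscriminantRootProduct.discr_prod_X_sub_C_eq_prod_prod_Ioi_sq, hd]
  have hμ : ∀ i j, (ξ j)⁻¹ - (ξ i)⁻¹ = (ξ i - ξ j) / (ξ i * ξ j) := by
    intro i j
    rw [inv_sub_inv (hi j) (hi i), mul_comm (ξ j) (ξ i)]
  have hsq : (∏ i : Fin N, ξ i) ^ (2 * (N - 1)) = ∏ i : Fin N, ∏ j ∈ Ioi i, (ξ i * ξ j) ^ 2 := by
    rw [mul_comm 2, pow_mul, ← prod_prod_Ioi_mul_eq_pow, ← Finset.prod_pow]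
    exact Finset.prod_congr rfl fun i _ => (Finset.prod_pow _ _ _).symm
  rw [hsq, ← Finset.prod_mul_distrib]
  refine Finset.prod_congr rfl fun i _ => ?_
  rw [← Finset.prod_mul_distrib]
  refine Finset.prod_congr rfl fun j _ => ?_
  rw [hμ i j, div_pow, div_mul_cancel₀ _ (pow_ne_zero 2 (mul_ne_zero (hi i) (hi j)))]
  ring

/-- **`disc(χ_{A⁻¹}) · det(A)^{2(N−1)} = disc(χ_A)` over an algebraically closed field** (every `A` with `det A ≠ 0`). [cite: BasuPollackRoy2006, Ch. 4 §4.1] -/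
theorem discr_charpoly_inv_mul_det_pow_of_isAlgClosed [IsAlgClosed L] (A : Matrix (Fin N) (Fin N) L) (h : A.det ≠ 0) :
    (A⁻¹).charpoly.discr * A.det ^ (2 * (N - 1)) = A.charpoly.discr := by
  haveI : Infinite L := IsAlgClosed.instInfinite
  obtain ⟨ξ, hξ⟩ := exists_eq_prod_X_sub_C_of_splits (IsAlgClosed.splits A.charpoly) (Matrix.charpoly_monic A)
    (by rw [Matrix.charpoly_natDegree_eq_dim, Fintype.card_fin])
  exact discr_charpoly_inv_mul_det_pow_of_eq_prod A ξ hξ h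

end Field

/-! ## §2 Naturality and the universal matrix localised at `det X` -/

section Universal

variable {B B' : Type*} [CommRing B] [CommRing B'] (φ : B →+* B') {N : ℕ}

/-- Naturality of both sides under a ring map (for `det A` a unit): `φ(disc χ_{A⁻¹}·det A^{2(N−1)}) = disc χ_{(A.map φ)⁻¹}·det(A.map φ)^{2(N−1)}` and
`φ(disc χ_A) = disc χ_{A.map φ}` (★ `map_nonsing_inv_of_isUnit`, ★ `map_discr_charpoly`). [cite: BasuPollackRoy2006, Ch. 4 §4.3.1] -/
theorem map_invDiscr_sides (A : Matrix (Fin N) (Fin N) B) (h : IsUnit A.det) :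
    φ ((A⁻¹).charpoly.discr * A.det ^ (2 * (N - 1))) = ((A.map φ)⁻¹).charpoly.discr * (A.map φ).det ^ (2 * (N - 1)) ∧
    φ A.charpoly.discr = (A.map φ).charpoly.discr := by
  constructor
  · rw [map_mul, map_pow, map_discr_charpoly, map_nonsing_inv_of_isUnit φ A h, RingHom.map_det, RingHom.mapMatrix_apply]
  · exact map_discr_charpoly φ A

variable (N)

/-- **The identity for the universal matrix over `S_d = ℤ[X_ij][(det X)⁻¹]`** (a domain in which `det X` is a unit; embed in an algebraic closure and use §1).
[cite: BasuPollackRoy2006, Ch. 4 §4.3.1] -/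
theorem discr_charpoly_inv_mul_det_pow_localization :
    (((Matrix.mvPolynomialX (Fin N) (Fin N) ℤ).map
        (algebraMap (MvPolynomial (Fin N × Fin N) ℤ) (Localization.Away (Matrix.mvPolynomialX (Fin N) (Fin N) ℤ).det)))⁻¹).charpoly.discr *
      ((Matrix.mvPolynomialX (Fin N) (Fin N) ℤ).map
        (algebraMap (MvPolynomial (Fin N × Fin N) ℤ) (Localization.Away (Matrix.mvPolynomialX (Fin N) (Fin N) ℤ).det))).det ^ (2 * (N - 1)) =
    ((Matrix.mvPolynomialX (Fin N) (Fin N) ℤ).map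
        (algebraMap (MvPolynomial (Fin N × Fin N) ℤ) (Localization.Away (Matrix.mvPolynomialX (Fin N) (Fin N) ℤ).det))).charpoly.discr := by
  set S := MvPolynomial (Fin N × Fin N) ℤ with hS
  set d : S := (Matrix.mvPolynomialX (Fin N) (Fin N) ℤ).det with hd
  set Sd := Localization.Away d with hSd
  set X := (Matrix.mvPolynomialX (Fin N) (Fin N) ℤ).map (algebraMap S Sd) with hX
  have hd0 : d ≠ 0 := Matrix.det_mvPolynomialX_ne_zero (Fin N) ℤ
  haveI : IsDomain Sd := IsLocalization.isDomain_localization (powers_le_nonZeroDivisors_of_noZeroDivisors hd0)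
  have hXu : IsUnit X.det := by
    rw [hX, ← RingHom.mapMatrix_apply, ← RingHom.map_det]
    exact IsLocalization.Away.algebraMap_isUnit d
  set L := AlgebraicClosure (FractionRing Sd) with hL
  set ι : Sd →+* L := (algebraMap (FractionRing Sd) L).comp (algebraMap Sd (FractionRing Sd)) with hι
  have hιinj : Function.Injective ι := (algebraMap (FractionRing Sd) L).injective.comp (IsFractionRing.injective Sd (FractionRing Sd))
  have hL0 : (X.map ι).det ≠ 0 := by
    rw [← RingHom.mapMatrix_apply, ← RingHom.map_det]
    intro h0
    exact hXu.ne_zero (hιinj (by rw [h0, map_zero]))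
  have hfield := discr_charpoly_inv_mul_det_pow_of_isAlgClosed (X.map ι) hL0
  obtain ⟨h1, h2⟩ := map_invDiscr_sides ι X hXu
  exact hιinj (by rw [h1, h2, hfield])

end Universal

/-! ## §3 Every commutative ring; `GL_N` form; regularity of the inverse -/

section AnyRing

variable {R : Type*} [CommRing R] {N : ℕ}

/-- **`disc(χ_{A⁻¹}) · det(A)^{2(N−1)} = disc(χ_A)`** for every `A ∈ M_N(R)` with `det A` a unit, `R` any commutative ring (specialise §2 along the evaluation
`X_ij ↦ A_ij`, which inverts `det X ↦ det A` and so factors through `S_d`). [cite: BasuPollackRoy2006, Ch. 4 §4.3.1] [cite: HarishChandra1999AdmissibleDistributions, §17] -/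
theorem discr_charpoly_inv_mul_det_pow (A : Matrix (Fin N) (Fin N) R) (h : IsUnit A.det) :
    (A⁻¹).charpoly.discr * A.det ^ (2 * (N - 1)) = A.charpoly.discr := by
  set S := MvPolynomial (Fin N × Fin N) ℤ with hS
  set d : S := (Matrix.mvPolynomialX (Fin N) (Fin N) ℤ).det with hd
  set Sd := Localization.Away d with hSd
  set e : S →+* R := MvPolynomial.eval₂Hom (Int.castRingHom R) (fun p : Fin N × Fin N => A p.1 p.2) with he
  have hXe : (Matrix.mvPolynomialX (Fin N) (Fin N) ℤ).map e = A := Matrix.mvPolynomialX_map_eval₂ _ A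
  have hed : e d = A.det := by rw [hd, RingHom.map_det, RingHom.mapMatrix_apply, hXe]
  have heu : IsUnit (e d) := by rw [hed]; exact h
  set ê : Sd →+* R := IsLocalization.Away.lift d heu with hê
  have hcomp : ê.comp (algebraMap S Sd) = e := IsLocalization.Away.lift_comp d heu
  set X := (Matrix.mvPolynomialX (Fin N) (Fin N) ℤ).map (algebraMap S Sd) with hX
  have hXA : X.map ê = A := by rw [hX, Matrix.map_map, ← RingHom.coe_comp, hcomp, hXe]
  have hXu : IsUnit X.det := by
    rw [hX, ← RingHom.mapMatrix_apply, ← RingHom.map_det]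
    exact IsLocalization.Away.algebraMap_isUnit d
  have huniv := discr_charpoly_inv_mul_det_pow_localization N
  obtain ⟨h1, h2⟩ := map_invDiscr_sides ê X hXu
  rw [hXA] at h1 h2
  rw [← h1, ← h2]
  exact congrArg ê huniv

/-- **`GL_N` form**: `disc(χ_{g⁻¹}) · det(g)^{2(N−1)} = disc(χ_g)` for `g ∈ GL_N(R)`. [cite: HarishChandra1999AdmissibleDistributions, §17] -/
theorem discr_charpoly_coe_inv_mul_det_pow (g : GL (Fin N) R) :
    (((g⁻¹ : GL (Fin N) R) : Matrix (Fin N) (Fin N) R)).charpoly.discr * ((g : Matrix (Fin N) (Fin N) R)).det ^ (2 * (N - 1)) =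
      ((g : Matrix (Fin N) (Fin N) R)).charpoly.discr := by
  rw [Matrix.coe_units_inv]
  exact discr_charpoly_inv_mul_det_pow _ (Matrix.isUnits_det_units g)

/-- **`g⁻¹` is regular iff `g` is** (`disc χ_{g⁻¹}` and `disc χ_g` differ by the unit `det(g)^{2(N−1)}`; ★ `isUnit_discr_iff_separable_of_monic`).
[cite: Rogawski1990, §3.1 p. 19] [cite: HarishChandra1999AdmissibleDistributions, §17] -/
theorem isRegularElt_inv_iff (g : GL (Fin N) R) : Literature.NumberTheory.Rogawski1990.IsRegularElt g⁻¹ ↔ Literature.NumberTheory.Rogawski1990.IsRegularElt g := by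
  rw [Literature.NumberTheory.Rogawski1990.isRegularElt_iff, Literature.NumberTheory.Rogawski1990.isRegularElt_iff,
    ← Literature.LinearAlgebra.Matrix.isUnit_discr_iff_separable_of_monic (Matrix.charpoly_monic _),
    ← Literature.LinearAlgebra.Matrix.isUnit_discr_iff_separable_of_monic (Matrix.charpoly_monic _),
    ← discr_charpoly_coe_inv_mul_det_pow g]
  have hdet : IsUnit (((g : Matrix (Fin N) (Fin N) R)).det ^ (2 * (N - 1))) := (Matrix.isUnits_det_units g).pow _
  exact ⟨fun h => h.mul hdet, fun h => isUnit_of_mul_isUnit_left h⟩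

end AnyRing

end Summit.HodgeConjecture.HodgeConjecture.Cruxes.H413.K2E3CharpolyDiscrInv
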